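import Literature.Algebra.Homology.TensorObjFinrank
import Mathlib.LinearAlgebra.Trace
import HarnessLib

/-!
# Traces on `(C ⊗ D)ⁿ`: `tr((φ ⊗ ψ)ⁿ) = Σ_{i+j=n} tr(φⁱ)·tr(ψʲ)` (LEAF 1 of `Λ(φ ⊗ ψ) = Λ(φ)·Λ(ψ)`)

Layer `Literature/Algebra/Homology` (pure linear algebra over Mathlib; proved theorems only, 0 definitions, 0 named facts,
no instances, no notation) — the trace twin of row `TensorObjFinrank`'s `finrank_tensorObj_X`:
* `trace_pi_eq_sum` — a diagonal endomorphism `(x_j) ↦ (f_j x_j)` of a finite product `Π j, M j` of finite free modules has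
  trace `Σ_j tr(f_j)` (block-diagonal matrix in `Pi.basis`);
* `trace_lmap_eq_sum` — `tr(DirectSum.lmap f) = Σ_{i ∈ s} tr(f_i)` on `⨁ i, M i` over an ARBITRARY index type with summands
  trivial off a `Finset s` (evaluation equivalence onto `Π (i : s), M i`);
* **`trace_tensorHom_f`** — for bounded cochain complexes `C`, `D` over a field (`Cⁱ = 0` off `Icc a₁ b₁`, `Dʲ = 0` off
  `Icc a₂ b₂`) and `φ : C ⟶ C`, `ψ : D ⟶ D`: `tr((φ ⊗ ψ)ⁿ) = Σ_{(i,j) ∈ Icc a₁ b₁ ×ˢ Icc a₂ b₂, i+j=n} tr(φⁱ)·tr(ψʲ)`,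
  transporting `(φ ⊗ ψ)ⁿ` along the tree's term-level identification `Literature.Algebra.Homology.tensorObjXIsoDirectSum`
  (`(C ⊗ D)ⁿ ≅ ⨁_{i+j=n} Cⁱ ⊗ Dʲ`, cited and used as row `TensorObjFinrank` does, not restated) to `DirectSum.lmap (φⁱ ⊗ ψʲ)`
  (naturality `HomologicalComplex.ι_mapBifunctorMap`) and `LinearMap.trace_tensorProduct'`.
No homology of a tensor product is computed (no Künneth statement is used); LEAF 2 (`LefschetzNumberTensor`) sums with signs.
Library only (cell `pub-hodge-ring2`, count-neutral); proves nothing about any crux, route or conjecture.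

## References

* A. Hatcher, *Algebraic Topology* (2002), §2.C (Lefschetz numbers) and §3.B (products). [HatcherAT2002]
* S. Lang, *Algebra* (2002), Ch. XVI §2 (tensor products; `tr(f ⊗ g) = tr f · tr g`), Ch. XX §3. [Lang2002]
-/

open CategoryTheory CategoryTheory.Limits CategoryTheory.MonoidalCategory
open scoped DirectSum TensorProduct

universe u v w

namespace Literature.Algebra.Homology.LefschetzTensor

section Pi

variable {K : Type u} [CommRing K] {η : Type w} [Fintype η] (M : η → Type v)
  [∀ j, AddCommGroup (M j)] [∀ j, Module K (M j)] [∀ j, Module.Finite K (M j)] [∀ j, Module.Free K (M j)]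

/-- **`tr((x_j)_j ↦ (f_j x_j)_j) = Σ_j tr(f_j)`** on a finite product of finite free modules (the matrix in the product basis
`Pi.basis` is block diagonal). [cite: Lang2002, XVI §2] -/
theorem trace_pi_eq_sum (f : ∀ j, M j →ₗ[K] M j) :
    LinearMap.trace K (∀ j, M j) (LinearMap.pi fun j => f j ∘ₗ LinearMap.proj j) =
      ∑ j, LinearMap.trace K (M j) (f j) := by
  classical
  let b : ∀ j, Module.Basis (Module.Free.ChooseBasisIndex K (M j)) K (M j) := fun j => Module.Free.chooseBasis K (M j)
  rw [LinearMap.trace_eq_matrix_trace K (Pi.basis b), Matrix.trace, ← Finset.univ_sigma_univ, Finset.sum_sigma]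
  refine Finset.sum_congr rfl fun j _ => ?_
  rw [LinearMap.trace_eq_matrix_trace K (b j), Matrix.trace]
  refine Finset.sum_congr rfl fun x _ => ?_
  simp only [Matrix.diag_apply, LinearMap.toMatrix_apply, Pi.basis_apply, Pi.basis_repr, LinearMap.pi_apply,
    LinearMap.coe_comp, Function.comp_apply, LinearMap.coe_proj, Function.eval, Pi.single_eq_same]

end Pi

section DirectSum

variable {K : Type u} [CommRing K] {ι : Type w} [DecidableEq ι] (M : ι → Type v)
  [∀ i, AddCommGroup (M i)] [∀ i, Module K (M i)]

/-- Evaluation on a `Finset s` carrying the support is a linear equivalence `(⨁ i, M i) ≃ₗ[K] Π (i : s), M i` (explicit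
form of row `TensorObjFinrank`'s `nonempty_directSum_linearEquiv_pi`, with its computation rule). [cite: Lang2002, XX §3] -/
theorem exists_linearEquiv_pi_apply (s : Finset ι) (hs : ∀ i, i ∉ s → Subsingleton (M i)) :
    ∃ e : (⨁ i, M i) ≃ₗ[K] (∀ i : s, M i), ∀ (x : ⨁ i, M i) (i : s), e x i = x i := by
  let f : (⨁ i, M i) →ₗ[K] (∀ i : s, M i) := LinearMap.pi fun i => DirectSum.component K ι M i.1
  refine ⟨LinearEquiv.ofBijective f ⟨?_, ?_⟩, fun x i => rfl⟩
  · intro x y hxy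
    refine DirectSum.ext (β := M) fun i => ?_
    by_cases hi : i ∈ s
    · exact congrFun hxy ⟨i, hi⟩
    · haveI := hs i hi
      exact Subsingleton.elim _ _
  · intro y
    refine ⟨DirectSum.mk M s fun i => y ⟨i.1, i.2⟩, funext fun i => ?_⟩
    change (DirectSum.mk M s fun i => y ⟨i.1, i.2⟩) i.1 = y i
    rw [DirectSum.mk_apply_of_mem i.2]

/-- **`tr(DirectSum.lmap f) = Σ_{i ∈ s} tr(f_i)`** on `⨁ i, M i` (arbitrary index type) when the finite free `M i` are
trivial off the `Finset s`. [cite: Lang2002, XVI §2] -/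
theorem trace_lmap_eq_sum [∀ i, Module.Finite K (M i)] [∀ i, Module.Free K (M i)] (s : Finset ι)
    (hs : ∀ i, i ∉ s → Subsingleton (M i)) (f : ∀ i, M i →ₗ[K] M i) :
    LinearMap.trace K (⨁ i, M i) (DirectSum.lmap f) = ∑ i ∈ s, LinearMap.trace K (M i) (f i) := by
  obtain ⟨e, he⟩ := exists_linearEquiv_pi_apply (K := K) M s hs
  have hconj : e.conj (DirectSum.lmap f) = LinearMap.pi fun i : s => f i ∘ₗ LinearMap.proj i := by
    apply LinearMap.ext
    intro y
    funext i
    rw [LinearEquiv.conj_apply, LinearMap.comp_apply, LinearMap.comp_apply, LinearEquiv.coe_coe, LinearEquiv.coe_coe, he,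
      DirectSum.lmap_apply, ← he (e.symm y) i, e.apply_symm_apply]
    rfl
  rw [← LinearMap.trace_conj' (DirectSum.lmap f) e, hconj, trace_pi_eq_sum]
  exact Finset.sum_coe_sort s fun i => LinearMap.trace K (M i) (f i)

end DirectSum

/-! ### `tr((φ ⊗ ψ)ⁿ)` for bounded cochain complexes -/

section Tensor

variable {k : Type u} [Field k] (C D : CochainComplex (ModuleCat.{u} k) ℤ) (a₁ b₁ a₂ b₂ : ℤ)
  (hC : ∀ i, i ∉ Finset.Icc a₁ b₁ → IsZero (C.X i)) (hD : ∀ j, j ∉ Finset.Icc a₂ b₂ → IsZero (D.X j))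
  (φ : C ⟶ C) (ψ : D ⟶ D)

/-- Naturality of the summand inclusions: `ι_{i,j} ≫ (φ ⊗ ψ)ⁿ = (φⁱ ⊗ ψʲ) ≫ ι_{i,j}`, on elements.
[cite: HatcherAT2002, §3.B] -/
theorem tensorHom_f_ιTensorObj_apply (n : ℤ) (p : {p : ℤ × ℤ // p.1 + p.2 = n}) (x : TensorSummand C D n p) :
    (HomologicalComplex.tensorHom φ ψ).f n (HomologicalComplex.ιTensorObj C D p.1.1 p.1.2 n p.2 x) =
      HomologicalComplex.ιTensorObj C D p.1.1 p.1.2 n p.2 (TensorProduct.map (φ.f p.1.1).hom (ψ.f p.1.2).hom x) := by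
  have h := HomologicalComplex.ι_mapBifunctorMap φ ψ (curriedTensor (ModuleCat.{u} k)) (ComplexShape.up ℤ) p.1.1 p.1.2 n p.2
  have hx := congrArg (fun g => g x) h
  simp only [ModuleCat.comp_apply, curriedTensor_map_app, curriedTensor_obj_map] at hx
  have hmap : ∀ y : TensorSummand C D n p, (C.X p.1.1 ◁ ψ.f p.1.2) ((φ.f p.1.1 ▷ D.X p.1.2) y) =
      TensorProduct.map (φ.f p.1.1).hom (ψ.f p.1.2).hom y := by
    intro y
    induction y using TensorProduct.induction_on with
    | zero => simp only [map_zero]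
    | tmul a b => rfl
    | add a b ha hb => simp only [map_add, ha, hb]
  refine hx.trans ?_
  exact congrArg (fun z => HomologicalComplex.ιTensorObj C D p.1.1 p.1.2 n p.2 z) (hmap x)

/-- Under `(C ⊗ D)ⁿ ≅ ⨁_{i+j=n} Cⁱ ⊗ Dʲ`, `(φ ⊗ ψ)ⁿ` becomes `DirectSum.lmap (φⁱ ⊗ ψʲ)`. [cite: HatcherAT2002, §3.B] -/
theorem conj_tensorHom_f_eq_lmap (n : ℤ) :
    (tensorObjXIsoDirectSum C D n).toLinearEquiv.conj ((HomologicalComplex.tensorHom φ ψ).f n).hom =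
      DirectSum.lmap fun p : {p : ℤ × ℤ // p.1 + p.2 = n} => TensorProduct.map (φ.f p.1.1).hom (ψ.f p.1.2).hom := by
  refine DirectSum.linearMap_ext k fun p => LinearMap.ext fun x => ?_
  rw [LinearMap.comp_apply, LinearMap.comp_apply, DirectSum.lmap_lof, LinearEquiv.conj_apply, LinearMap.comp_apply,
    LinearMap.comp_apply, LinearEquiv.coe_coe, LinearEquiv.coe_coe, Iso.toLinearEquiv_symm, Iso.toLinearEquiv_apply,
    Iso.toLinearEquiv_apply, Iso.symm_hom, tensorObjXIsoDirectSum_inv_lof, tensorHom_f_ιTensorObj_apply]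
  have e := ιTensorObj_tensorObjXIsoDirectSum_hom C D n p.1.1 p.1.2 p.2
  exact (congrArg (fun g => g (TensorProduct.map (φ.f p.1.1).hom (ψ.f p.1.2).hom x)) e).trans
    (lofHom_apply C D n p.1.1 p.1.2 p.2 _)

include hC hD in
/-- **`tr((φ ⊗ ψ)ⁿ) = Σ_{(i,j) ∈ Icc a₁ b₁ ×ˢ Icc a₂ b₂, i+j=n} tr(φⁱ)·tr(ψʲ)`** for endomorphisms of bounded cochain complexes
of finite-dimensional vector spaces. [cite: HatcherAT2002, §3.B] [cite: Lang2002, XVI §2] -/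
theorem trace_tensorHom_f [∀ i, Module.Finite k (C.X i)] [∀ j, Module.Finite k (D.X j)] (n : ℤ) :
    LinearMap.trace k ((HomologicalComplex.tensorObj C D).X n) ((HomologicalComplex.tensorHom φ ψ).f n).hom =
      ∑ p ∈ (Finset.Icc a₁ b₁ ×ˢ Finset.Icc a₂ b₂).filter (fun p : ℤ × ℤ => p.1 + p.2 = n),
        LinearMap.trace k (C.X p.1) (φ.f p.1).hom * LinearMap.trace k (D.X p.2) (ψ.f p.2).hom := by
  rw [← LinearMap.trace_conj' _ (tensorObjXIsoDirectSum C D n).toLinearEquiv, conj_tensorHom_f_eq_lmap,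
    trace_lmap_eq_sum (TensorSummand C D n) _ (TensorObjFinrank.subsingleton_tensorSummand C D a₁ b₁ a₂ b₂ hC hD n),
    ← Finset.sum_subtype_eq_sum_filter]
  exact Finset.sum_congr rfl fun p _ => LinearMap.trace_tensorProduct' _ _

end Tensor

end Literature.Algebra.Homology.LefschetzTensor
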